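import Mathlib.LinearAlgebra.Matrix.Adjugate
import Literature.Analysis.FluidPDE.OnsagerBDSVOscillationSplit
import Literature.Analysis.FluidPDE.OnsagerBDSVFlowJacobian
import HarnessLib

/-!
# The BDSV principal oscillation term `𝒪₁`: the identity (6.10)

Buckmaster–De Lellis–Székelyhidi–Vicol (BDSV), *Onsager's conjecture for admissible weak
solutions*, CPAM 72 (2019) = arXiv:1701.08678, §6.1.3, estimate the principal oscillation term
`𝒪₁ = ℛ div(w_o ⊗ w_o - R̄_q)` (the named fact `BDSV.oscillationPrincipalEstimate` of
`OnsagerBDSVOscillationSplit.lean`) starting from two identities: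

> "Due to the supports of the cutoffs `η_j` being mutually disjoint, we have
> `𝒪₁ = ℛ div(-R̄_q + Σ_i w_{o,i} ⊗ w_{o,i})`. Using the definition of `w_{o,i}` and (5.6), the
> tensor `w_{o,i} ⊗ w_{o,i}` may be written as
> (6.10) `w_{o,i} ⊗ w_{o,i} = ρ_{q,i} ∇Φ_i⁻¹ (W ⊗ W)(R̃_{q,i}, λ_{q+1}Φ_i) ∇Φ_i⁻ᵀ`
> `= ρ_{q,i} ∇Φ_i⁻¹ R̃_{q,i} ∇Φ_i⁻ᵀ + Σ_{k≠0} ρ_{q,i} ∇Φ_i⁻¹ C_k(R̃_{q,i}) ∇Φ_i⁻ᵀ e^{iλ_{q+1}k·Φ_i}`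
> `= R_{q,i} + Σ_{k≠0} ρ_{q,i} ∇Φ_i⁻¹ C_k(R̃_{q,i}) ∇Φ_i⁻ᵀ e^{iλ_{q+1}k·Φ_i}`"

(arXiv numbering; (5.6) is the Fourier expansion `W ⊗ W(R, ξ) = R + Σ_{k≠0} C_k(R) e^{ik·ξ}` of
the Mikado flows). This file PROVES the physical-space content of these identities for the honest
objects of the tree (`BDSV.principalPart`, `BDSV.stressSum`, `BDSV.tildeR`, `BDSV.gradPhi` of
`OnsagerBDSVPerturbation.lean` / `OnsagerBDSVEnergy.lean`, for an arbitrary `BDSV.MikadoDatum`):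

* `BDSV.MikadoDatum.oscMatrix 𝔚 R ξ = W(R,ξ) ⊗ W(R,ξ) - R` — the **mean-free Mikado tensor**, the
  function `Σ_{k≠0} C_k(R) e^{ik·ξ}` of (5.6): symmetric, of zero mean in `ξ` (`⨍ W ⊗ W = R`,
  Lemma 5.1) and divergence free in `ξ` (`div_ξ(W ⊗ W) = 0`, Lemma 5.1 — the physical-space form
  of `C_k k = 0`, (5.7));
* `BDSV.principalSummand … i = w_{o,i} = ρ_{q,i}^{1/2} adj(∇Φ_i) W(R̃_{q,i}, n_{q+1}Φ_i)` with
  `w_o = Σ_i w_{o,i}` (`rfl`), `BDSV.stressSummand … i = R_{q,i}` (columns) with `R̄_q = Σ_i R_{q,i}`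
  (`rfl`), and the disjointness `(w_{o,i})_j w_{o,i'} = 0` for `i ≠ i'`, whence
  `w_o ⊗ w_o = Σ_i w_{o,i} ⊗ w_{o,i}` (`BDSV.principalPart_tensor_eq_sum`);
* the matrix algebra of (6.10): with `A = adj ∇Φ_i` (`= ∇Φ_i⁻¹` as `det ∇Φ_i = 1`,
  `OnsagerBDSVFlowJacobian.lean`), `ρ_{q,i} A R̃_{q,i} Aᵀ = ρ_{q,i} Id - η_i² R̊̄_q = R_{q,i}`
  (`BDSV.rhoI_smul_adjugate_mul_tildeR`, from the form (5.32) of `R̃_{q,i}`), so that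
  **`w_{o,i} ⊗ w_{o,i} - R_{q,i} = ρ_{q,i} A 𝕎(R̃_{q,i}, n_{q+1}Φ_i) Aᵀ`** with the mean-free Mikado
  tensor `𝕎` (`BDSV.principalSummand_tensor_sub_stressSummand`), and summing,
  **`w_o ⊗ w_o - R̄_q = Σ_i ρ_{q,i} adj(∇Φ_i) 𝕎(R̃_{q,i}, n_{q+1}Φ_i) adj(∇Φ_i)ᵀ`**
  (`BDSV.oscPrincipalTensor_eq_sum`; under the standing hypotheses
  `BDSV.PerturbationData.oscPrincipalTensor_eq_sum`).

Expanding `𝕎(R, ξ)` in its Fourier series in `ξ` turns the last identity into (6.10) summed over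
`i`; that expansion, the cancellation `C_k k = 0` of the fast derivative and the estimate (6.11)
are the subject of later files.

## References

* T. Buckmaster, C. De Lellis, L. Székelyhidi Jr., V. Vicol, *Onsager's conjecture for admissible
  weak solutions*, Comm. Pure Appl. Math. 72 (2019) 229–274 = arXiv:1701.08678, §6.1.3
  (arXiv (6.10)), §5.1 Lemma 5.1 with (5.6)–(5.7), §5.2 (`R_{q,i}`, (5.17)), §5.3 (5.20),
  §5.5 (5.32). Equation numbers as in arXiv:1701.08678v1 (cf. `OnsagerBDSVStressSplit.lean`,
  "Numbering").
-/

open MeasureTheory Set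
open scoped NNReal ENNReal ContDiff Matrix Matrix.Norms.Elementwise

noncomputable section

namespace Literature.Analysis.FluidPDE

namespace BDSV

open FunctionSpaces FunctionSpaces.Torus

/-- The flat three-torus `T³ = (ℝ/ℤ)³`, local notation. -/
local notation "𝕋³" => UnitAddTorus (Fin 3)

/-- Euclidean `ℝ³`, local notation. -/
local notation "ℝ³" => EuclideanSpace ℝ (Fin 3)

/-- Real `3 × 3` matrices, local notation. -/
local notation "𝕄" => Matrix (Fin 3) (Fin 3) ℝ

/-! ## Columns of a matrix -/

section Cols

/-- The columns of a `3 × 3` matrix as vectors of `ℝ³`, `colsOf M j = (M a j)_a` — the inverse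
of `BDSV.ofCols` (the column convention of `Torus.tensorDivergence`). [folklore] -/
def colsOf (M : 𝕄) (j : Fin 3) : ℝ³ := WithLp.toLp 2 fun a => M a j

/-- Entries of `colsOf`. [folklore] -/
@[simp] theorem colsOf_apply (M : 𝕄) (j a : Fin 3) : colsOf M j a = M a j := rfl

/-- `ofCols (colsOf M) = M`. [folklore] -/
@[simp] theorem ofCols_colsOf (M : 𝕄) : ofCols (colsOf M) = M := by
  ext a b
  simp

/-- `colsOf (ofCols S) = S`. [folklore] -/
@[simp] theorem colsOf_ofCols (S : Fin 3 → ℝ³) : colsOf (ofCols S) = S := by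
  funext j
  ext a
  simp

/-- `colsOf` is additive. [folklore] -/
theorem colsOf_add (M N : 𝕄) (j : Fin 3) : colsOf (M + N) j = colsOf M j + colsOf N j := by
  ext a
  simp

/-- `colsOf` commutes with subtraction. [folklore] -/
theorem colsOf_sub (M N : 𝕄) (j : Fin 3) : colsOf (M - N) j = colsOf M j - colsOf N j := by
  ext a
  simp

/-- `colsOf` commutes with scalars. [folklore] -/
theorem colsOf_smul (c : ℝ) (M : 𝕄) (j : Fin 3) : colsOf (c • M) j = c • colsOf M j := by
  ext a
  simp

/-- `colsOf 0 = 0`. [folklore] -/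
@[simp] theorem colsOf_zero (j : Fin 3) : colsOf (0 : 𝕄) j = 0 := by
  ext a
  simp

/-- `colsOf` commutes with finite sums. [folklore] -/
theorem colsOf_sum {ι : Type*} (s : Finset ι) (M : ι → 𝕄) (j : Fin 3) :
    colsOf (∑ i ∈ s, M i) j = ∑ i ∈ s, colsOf (M i) j := by
  ext a
  simp [Matrix.sum_apply]

/-- The columns of the identity matrix are the standard basis vectors. [folklore] -/
theorem colsOf_one (j : Fin 3) : colsOf (1 : 𝕄) j = EuclideanSpace.single j (1 : ℝ) := by
  ext a
  simp [Matrix.one_apply, eq_comm]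

/-- The columns of `u ⊗ u = u uᵀ` are `u_j u`. [folklore] -/
theorem colsOf_vecMulVec (u : Fin 3 → ℝ) (j : Fin 3) :
    colsOf (Matrix.vecMulVec u u) j = u j • WithLp.toLp 2 u := by
  ext a
  simp [Matrix.vecMulVec_apply, mul_comm]

end Cols

/-! ## The mean-free Mikado tensor `W ⊗ W - R` -/

section MikadoTensor

variable {r : ℝ}

/-- **The mean-free Mikado tensor** `𝕎(R, ξ) = W(R,ξ) ⊗ W(R,ξ) - R` of a Mikado datum — the
function `Σ_{k≠0} C_k(R) e^{ik·ξ}` of the Fourier expansion (5.6)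
`W ⊗ W(R, ξ) = R + Σ_{k≠0} C_k(R) e^{ik·ξ}`. [cite: BuckmasterEtAl2018, §5.1 (5.6)] -/
def MikadoDatum.oscMatrix (𝔚 : MikadoDatum r) (R : 𝕄) (ξ : 𝕋³) : 𝕄 :=
  Matrix.vecMulVec (𝔚.W R ξ) (𝔚.W R ξ) - R

/-- Entries of the mean-free Mikado tensor: `𝕎_{ab} = W_a W_b - R_{ab}`. [folklore] -/
theorem MikadoDatum.oscMatrix_apply (𝔚 : MikadoDatum r) (R : 𝕄) (ξ : 𝕋³) (a b : Fin 3) :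
    𝔚.oscMatrix R ξ a b = 𝔚.W R ξ a * 𝔚.W R ξ b - R a b := by
  simp [MikadoDatum.oscMatrix, Matrix.vecMulVec_apply]

/-- The mean-free Mikado tensor is symmetric for symmetric `R`. [folklore] -/
theorem MikadoDatum.isSymm_oscMatrix (𝔚 : MikadoDatum r) {R : 𝕄} (hR : R.IsSymm) (ξ : 𝕋³) :
    (𝔚.oscMatrix R ξ).IsSymm := by
  unfold Matrix.IsSymm
  ext a b
  rw [Matrix.transpose_apply, 𝔚.oscMatrix_apply, 𝔚.oscMatrix_apply, mul_comm]
  congr 1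
  exact hR.apply a b

/-- The columns of the mean-free Mikado tensor: `W_j W - R e_j`. [folklore] -/
theorem MikadoDatum.colsOf_oscMatrix (𝔚 : MikadoDatum r) (R : 𝕄) (ξ : 𝕋³) (j : Fin 3) :
    colsOf (𝔚.oscMatrix R ξ) j = 𝔚.W R ξ j • 𝔚.W R ξ - colsOf R j := by
  rw [MikadoDatum.oscMatrix, colsOf_sub, colsOf_vecMulVec]

/-- The Mikado flows `W(R, ·)` are smooth on `T³` for each `R`. [folklore] -/
theorem MikadoDatum.isSmooth_W (𝔚 : MikadoDatum r) (R : 𝕄) : IsSmooth (𝔚.W R) :=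
  𝔚.smooth_W.comp (contDiff_const.prodMk contDiff_id)

/-- The columns of the mean-free Mikado tensor are smooth in `ξ`. [folklore] -/
theorem MikadoDatum.isSmooth_colsOf_oscMatrix (𝔚 : MikadoDatum r) (R : 𝕄) :
    IsSmooth (fun ξ => colsOf (𝔚.oscMatrix R ξ)) := by
  have h : (fun ξ => colsOf (𝔚.oscMatrix R ξ)) =
      fun ξ j => 𝔚.W R ξ j • 𝔚.W R ξ - colsOf R j := by
    funext ξ
    funext j
    exact 𝔚.colsOf_oscMatrix R ξ j
  rw [h]
  exact contDiff_pi.2 fun j => (((𝔚.isSmooth_W R).apply j).smul' (𝔚.isSmooth_W R)).sub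
    (isSmooth_const _)

/-- **`⨍ 𝕎(R, ξ) dξ = 0`** on the Mikado ball (`⨍ W ⊗ W = R`, Lemma 5.1): the zero mode of
(5.6) is `R`. [cite: BuckmasterEtAl2018, Lemma 5.1 (⨍ W ⊗ W = R) and (5.6)] -/
theorem MikadoDatum.integral_oscMatrix_apply (𝔚 : MikadoDatum r) {R : 𝕄}
    (hR : R ∈ Metric.closedBall (1 : 𝕄) r) (hRs : R.IsSymm) (a b : Fin 3) :
    ∫ ξ, 𝔚.oscMatrix R ξ a b = 0 := by
  simp_rw [𝔚.oscMatrix_apply]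
  have hs : IsSmooth fun ξ => 𝔚.W R ξ a * 𝔚.W R ξ b :=
    ContDiff.mul ((𝔚.isSmooth_W R).apply a) ((𝔚.isSmooth_W R).apply b)
  have hi : Integrable (fun ξ => 𝔚.W R ξ a * 𝔚.W R ξ b) volume := hs.integrable
  rw [integral_sub hi (integrable_const _), 𝔚.integral_WW R hR hRs a b]
  simp

/-- **`div_ξ 𝕎(R, ·) = 0`** on the Mikado ball (`div_ξ(W ⊗ W) = (W·∇)W + (div W) W = 0`,
Lemma 5.1; the physical-space form of `C_k k = 0`, (5.7)). [cite: BuckmasterEtAl2018, Lemma 5.1 (5.4) and (5.7)] -/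
theorem MikadoDatum.tensorDivergence_oscMatrix (𝔚 : MikadoDatum r) {R : 𝕄}
    (hR : R ∈ Metric.closedBall (1 : 𝕄) r) (hRs : R.IsSymm) (ξ : 𝕋³) :
    Torus.tensorDivergence (fun ζ => colsOf (𝔚.oscMatrix R ζ)) ξ = 0 := by
  have hW := 𝔚.isSmooth_W R
  have hA : IsSmooth (fun ζ j => 𝔚.W R ζ j • 𝔚.W R ζ) :=
    contDiff_pi.2 fun j => (hW.apply j).smul' hW
  have hB : IsSmooth (fun (_ : 𝕋³) (j : Fin 3) => colsOf R j) := isSmooth_const _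
  have h : (fun ζ => colsOf (𝔚.oscMatrix R ζ)) =
      fun ζ j => 𝔚.W R ζ j • 𝔚.W R ζ - colsOf R j := by
    funext ζ
    funext j
    exact 𝔚.colsOf_oscMatrix R ζ j
  rw [h, tensorDivergence_sub hA hB, tensorDivergence_smul_self hW (𝔚.divFree_W R hR hRs),
    𝔚.convect_W R hR hRs ξ, zero_sub, neg_eq_zero, Torus.tensorDivergence]
  exact Finset.sum_eq_zero fun j _ => Torus.partialDeriv_const_apply _ _ _

end MikadoTensor

/-! ## The summands `w_{o,i}` and `R_{q,i}`; disjointness -/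

section Summands

variable (P : Params) (S : Setting)

/-- **The `i`-th principal summand** `w_{o,i} = ρ_{q,i}^{1/2} ∇Φ_i⁻¹ W(R̃_{q,i}, λ_{q+1}Φ_i)` of
(5.20), with `∇Φ_i⁻¹` written as the adjugate (as in `BDSV.principalPart`) and the `1`-periodic
profile at `n_{q+1}Φ_i`. [cite: BuckmasterEtAl2018, §5.3 (5.20)] -/
def principalSummand (𝔚 : MikadoDatum mikadoRadius) (η : ℕ → ℝ → 𝕋³ → ℝ)
    (D : ℕ → ℝ → 𝕋³ → ℝ³) (i : ℕ) (t : ℝ) (x : 𝕋³) : ℝ³ :=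
  sqrtRhoI P S η i t x •
    Matrix.toEuclideanLin (gradPhi D i t x).adjugate
      (𝔚.W (tildeR P S η D i t x) (P.freqNat (S.q + 1) • phiPoint D i t x))

/-- **The stress `R_{q,i} = ρ_{q,i} Id - η_i² R̊̄_q`** of §5.2, by columns (the `i`-th summand of
`R̄_q = BDSV.stressSum`). [cite: BuckmasterEtAl2018, §5.2 (R_{q,i})] -/
def stressSummand (η : ℕ → ℝ → 𝕋³ → ℝ) (i : ℕ) (t : ℝ) (x : 𝕋³) (j : Fin 3) : ℝ³ :=
  rhoI P S η i t x • EuclideanSpace.single j (1 : ℝ) - η i t x ^ 2 • S.Rbar t x j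

/-- **The conjugated mean-free Mikado tensor** of the `i`-th cut-off,
`ρ_{q,i} adj(∇Φ_i) 𝕎(R̃_{q,i}, n_{q+1}Φ_i) adj(∇Φ_i)ᵀ` — the oscillatory part
`Σ_{k≠0} ρ_{q,i} ∇Φ_i⁻¹ C_k(R̃_{q,i}) ∇Φ_i⁻ᵀ e^{iλ_{q+1}k·Φ_i}` of (6.10) before Fourier expansion.
[cite: BuckmasterEtAl2018, §6.1.3 (arXiv (6.10))] -/
def principalOscMatrix (𝔚 : MikadoDatum mikadoRadius) (η : ℕ → ℝ → 𝕋³ → ℝ)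
    (D : ℕ → ℝ → 𝕋³ → ℝ³) (i : ℕ) (t : ℝ) (x : 𝕋³) : 𝕄 :=
  rhoI P S η i t x •
    ((gradPhi D i t x).adjugate *
      𝔚.oscMatrix (tildeR P S η D i t x) (P.freqNat (S.q + 1) • phiPoint D i t x) *
      ((gradPhi D i t x).adjugate)ᵀ)

variable {P S}
variable (𝔚 : MikadoDatum mikadoRadius) (η : ℕ → ℝ → 𝕋³ → ℝ) (D : ℕ → ℝ → 𝕋³ → ℝ³)

/-- `w_o = Σ_i w_{o,i}` (5.20). [cite: BuckmasterEtAl2018, §5.3 (5.20)] -/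
theorem principalPart_eq_sum (t : ℝ) (x : 𝕋³) :
    principalPart P S 𝔚 η D t x =
      ∑ i ∈ Finset.range (cutoffCount S.T (P.τ S.q)), principalSummand P S 𝔚 η D i t x :=
  rfl

/-- `R̄_q = Σ_i R_{q,i}` (§5.3). [cite: BuckmasterEtAl2018, §5.3 (R̄_q)] -/
theorem stressSum_eq_sum (t : ℝ) (x : 𝕋³) (j : Fin 3) :
    stressSum P S η t x j =
      ∑ i ∈ Finset.range (cutoffCount S.T (P.τ S.q)), stressSummand P S η i t x j :=
  rfl

/-- Off the support of `η_i` the summand `w_{o,i}` vanishes. [folklore] -/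
theorem principalSummand_eq_zero_of_eta_eq_zero {i : ℕ} {t : ℝ} {x : 𝕋³} (h : η i t x = 0) :
    principalSummand P S 𝔚 η D i t x = 0 := by
  rw [principalSummand, sqrtRhoI, h, zero_mul, zero_smul]

/-- **Disjointness of the summands**: `(w_{o,i})_j w_{o,i'} = 0` for `i ≠ i'` when the cut-offs
have pointwise disjoint supports (§5.2 (ii)). [cite: BuckmasterEtAl2018, §5.2 (ii) and §6.1.3] -/
theorem principalSummand_apply_smul_principalSummand_eq_zero {i i' : ℕ} {t : ℝ} {x : 𝕋³}
    (hdisj : η i t x = 0 ∨ η i' t x = 0) (j : Fin 3) :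
    principalSummand P S 𝔚 η D i t x j • principalSummand P S 𝔚 η D i' t x = 0 := by
  rcases hdisj with h | h
  · rw [principalSummand_eq_zero_of_eta_eq_zero 𝔚 η D h, PiLp.zero_apply, zero_smul]
  · rw [principalSummand_eq_zero_of_eta_eq_zero 𝔚 η D h, smul_zero]

/-- **`w_o ⊗ w_o = Σ_i w_{o,i} ⊗ w_{o,i}`** (columns `(w_o)_j w_o`), "due to the supports of the
cutoffs `η_j` being mutually disjoint". [cite: BuckmasterEtAl2018, §6.1.3 (𝒪₁ = ℛ div(-R̄_q + Σ_i w_{o,i} ⊗ w_{o,i}))] -/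
theorem principalPart_tensor_eq_sum {t : ℝ} {x : 𝕋³}
    (hdisj : ∀ i i', i ≠ i' → η i t x = 0 ∨ η i' t x = 0) (j : Fin 3) :
    principalPart P S 𝔚 η D t x j • principalPart P S 𝔚 η D t x =
      ∑ i ∈ Finset.range (cutoffCount S.T (P.τ S.q)),
        principalSummand P S 𝔚 η D i t x j • principalSummand P S 𝔚 η D i t x := by
  rw [principalPart_eq_sum, WithLp.ofLp_sum, Finset.sum_apply, Finset.sum_smul]
  refine Finset.sum_congr rfl fun i hi => ?_
  rw [Finset.smul_sum, Finset.sum_eq_single i]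
  · intro i' _ hi'i
    exact principalSummand_apply_smul_principalSummand_eq_zero 𝔚 η D (hdisj i i' (Ne.symm hi'i)) j
  · intro h
    exact absurd hi h

end Summands

/-! ## The matrix algebra of (6.10) -/

section Algebra

variable {P : Params} {S : Setting}
variable (𝔚 : MikadoDatum mikadoRadius) (η : ℕ → ℝ → 𝕋³ → ℝ) (D : ℕ → ℝ → 𝕋³ → ℝ³)

/-- `adj(∇Φ) ∇Φ = Id` when `det ∇Φ = 1`. [folklore] -/
theorem adjugate_mul_gradPhi {i : ℕ} {t : ℝ} {x : 𝕋³} (hdet : (gradPhi D i t x).det = 1) :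
    (gradPhi D i t x).adjugate * gradPhi D i t x = 1 := by
  rw [Matrix.adjugate_mul, hdet, one_smul]

/-- **`adj(∇Φ_i) R̃_{q,i} adj(∇Φ_i)ᵀ = Id - (Σ_j∫η_j²/ρ_q) R̊̄_q`** when `det ∇Φ_i = 1`: conjugating
the form (5.32) `R̃_{q,i} = ∇Φ_i (Id - (Σ∫η_j²/ρ_q) R̊̄_q) ∇Φ_iᵀ` back. [cite: BuckmasterEtAl2018, §5.5 (5.32)] -/
theorem adjugate_mul_tildeR_mul_adjugate_transpose {i : ℕ} {t : ℝ} {x : 𝕋³}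
    (hdet : (gradPhi D i t x).det = 1) :
    (gradPhi D i t x).adjugate * tildeR P S η D i t x * ((gradPhi D i t x).adjugate)ᵀ =
      1 - (etaMass P S η t / rhoQ P S t) • ofCols (S.Rbar t x) := by
  have h1 := adjugate_mul_gradPhi D hdet
  have h2 : (gradPhi D i t x)ᵀ * ((gradPhi D i t x).adjugate)ᵀ = 1 := by
    rw [← Matrix.transpose_mul, h1, Matrix.transpose_one]
  rw [tildeR]
  calc (gradPhi D i t x).adjugate *
        (gradPhi D i t x * (1 - (etaMass P S η t / rhoQ P S t) • ofCols (S.Rbar t x)) *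
          (gradPhi D i t x)ᵀ) * ((gradPhi D i t x).adjugate)ᵀ
      = ((gradPhi D i t x).adjugate * gradPhi D i t x) *
          (1 - (etaMass P S η t / rhoQ P S t) • ofCols (S.Rbar t x)) *
          ((gradPhi D i t x)ᵀ * ((gradPhi D i t x).adjugate)ᵀ) := by
        simp only [Matrix.mul_assoc]
    _ = _ := by rw [h1, h2, Matrix.one_mul, Matrix.mul_one]

/-- **`ρ_{q,i} adj(∇Φ_i) R̃_{q,i} adj(∇Φ_i)ᵀ = ρ_{q,i} Id - η_i² R̊̄_q = R_{q,i}`** (the step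
"`ρ_{q,i} ∇Φ_i⁻¹ R̃_{q,i} ∇Φ_i⁻ᵀ = R_{q,i}`" of (6.10)), for `det ∇Φ_i = 1`, `ρ_q ≠ 0`,
`Σ_j∫η_j² ≠ 0`. [cite: BuckmasterEtAl2018, §6.1.3 (arXiv (6.10)) and §5.2 (5.17)] -/
theorem rhoI_smul_adjugate_mul_tildeR {i : ℕ} {t : ℝ} {x : 𝕋³} (hdet : (gradPhi D i t x).det = 1)
    (hρ : rhoQ P S t ≠ 0) (hm : etaMass P S η t ≠ 0) :
    rhoI P S η i t x •
        ((gradPhi D i t x).adjugate * tildeR P S η D i t x * ((gradPhi D i t x).adjugate)ᵀ) =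
      rhoI P S η i t x • (1 : 𝕄) - η i t x ^ 2 • ofCols (S.Rbar t x) := by
  rw [adjugate_mul_tildeR_mul_adjugate_transpose η D hdet, smul_sub, smul_smul]
  congr 2
  rw [rhoI]
  field_simp

/-- The columns of `R_{q,i}` are those of `ρ_{q,i} Id - η_i² R̊̄_q`. [folklore] -/
theorem stressSummand_eq_colsOf (i : ℕ) (t : ℝ) (x : 𝕋³) (j : Fin 3) :
    stressSummand P S η i t x j =
      colsOf (rhoI P S η i t x • (1 : 𝕄) - η i t x ^ 2 • ofCols (S.Rbar t x)) j := by
  rw [stressSummand, colsOf_sub, colsOf_smul, colsOf_smul, colsOf_one, colsOf_ofCols]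

/-- `(ρ^{1/2}_{q,i})² = ρ_{q,i}` when `ρ_q/Σ∫η_j² ≥ 0`. [folklore] -/
theorem sqrtRhoI_mul_self {i : ℕ} {t : ℝ} (h : 0 ≤ rhoQ P S t / etaMass P S η t) (x : 𝕋³) :
    sqrtRhoI P S η i t x * sqrtRhoI P S η i t x = rhoI P S η i t x := by
  rw [sqrtRhoI, rhoI, mul_mul_mul_comm, Real.mul_self_sqrt h, pow_two]

/-- `(A u) ⊗ (A u) = A (u ⊗ u) Aᵀ` for a matrix `A` and a vector `u` (columns). [folklore] -/
theorem toEuclideanLin_apply_smul_toEuclideanLin (A : 𝕄) (u : ℝ³) (j : Fin 3) :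
    Matrix.toEuclideanLin A u j • Matrix.toEuclideanLin A u =
      colsOf (A * Matrix.vecMulVec u u * Aᵀ) j := by
  have h : Matrix.toEuclideanLin A u = WithLp.toLp 2 (A *ᵥ WithLp.ofLp u) := rfl
  rw [h, Matrix.mul_vecMulVec, Matrix.vecMulVec_mul, Matrix.vecMul_transpose, colsOf_vecMulVec]

/-- `(σ A u) ⊗ (σ A u) = σ² A (u ⊗ u) Aᵀ` (columns). [folklore] -/
theorem smul_toEuclideanLin_tensor (σ : ℝ) (A : 𝕄) (u : ℝ³) (j : Fin 3) :
    (σ • Matrix.toEuclideanLin A u) j • (σ • Matrix.toEuclideanLin A u) =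
      (σ * σ) • colsOf (A * Matrix.vecMulVec u u * Aᵀ) j := by
  rw [PiLp.smul_apply, smul_eq_mul, smul_smul, mul_right_comm, ← smul_smul,
    toEuclideanLin_apply_smul_toEuclideanLin]

/-- **The identity (6.10), physical-space form**: for `det ∇Φ_i = 1`, `ρ_q > 0` and
`Σ_j∫η_j² > 0`,
`w_{o,i} ⊗ w_{o,i} - R_{q,i} = ρ_{q,i} adj(∇Φ_i) 𝕎(R̃_{q,i}, n_{q+1}Φ_i) adj(∇Φ_i)ᵀ`
(columns), `𝕎 = W ⊗ W - R` the mean-free Mikado tensor: indeed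
`w_{o,i} ⊗ w_{o,i} = ρ_{q,i} A (W ⊗ W)(R̃_{q,i}, n_{q+1}Φ_i) Aᵀ` and `ρ_{q,i} A R̃_{q,i} Aᵀ = R_{q,i}`,
`A = adj ∇Φ_i = ∇Φ_i⁻¹`. [cite: BuckmasterEtAl2018, §6.1.3 (arXiv (6.10))] -/
theorem principalSummand_tensor_sub_stressSummand {i : ℕ} {t : ℝ} {x : 𝕋³}
    (hdet : (gradPhi D i t x).det = 1) (hρ : 0 < rhoQ P S t) (hm : 0 < etaMass P S η t)
    (j : Fin 3) :
    principalSummand P S 𝔚 η D i t x j • principalSummand P S 𝔚 η D i t x -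
        stressSummand P S η i t x j =
      colsOf (principalOscMatrix P S 𝔚 η D i t x) j := by
  rw [principalSummand, smul_toEuclideanLin_tensor, sqrtRhoI_mul_self η (div_pos hρ hm).le x,
    stressSummand_eq_colsOf, ← rhoI_smul_adjugate_mul_tildeR η D hdet hρ.ne' hm.ne', ← colsOf_smul,
    ← colsOf_sub, ← smul_sub, principalOscMatrix, MikadoDatum.oscMatrix, Matrix.mul_sub,
    Matrix.sub_mul]

/-- **`w_o ⊗ w_o - R̄_q = Σ_i ρ_{q,i} adj(∇Φ_i) 𝕎(R̃_{q,i}, n_{q+1}Φ_i) adj(∇Φ_i)ᵀ`** (columns):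
the tensor under `ℛ div` in `𝒪₁` (`BDSV.oscPrincipalTensor`) is the sum over the cut-offs of the
conjugated mean-free Mikado tensors — (6.10) summed over `i`, before Fourier expansion — provided
the cut-offs are pointwise disjoint, `det ∇Φ_i = 1`, `ρ_q > 0` and `Σ_j∫η_j² > 0`.
[cite: BuckmasterEtAl2018, §6.1.3 (arXiv (6.10))] -/
theorem oscPrincipalTensor_eq_sum {t : ℝ} {x : 𝕋³}
    (hdisj : ∀ i i', i ≠ i' → η i t x = 0 ∨ η i' t x = 0)
    (hdet : ∀ i, (gradPhi D i t x).det = 1) (hρ : 0 < rhoQ P S t) (hm : 0 < etaMass P S η t)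
    (j : Fin 3) :
    oscPrincipalTensor P S 𝔚 η D t x j =
      ∑ i ∈ Finset.range (cutoffCount S.T (P.τ S.q)), colsOf (principalOscMatrix P S 𝔚 η D i t x) j := by
  rw [oscPrincipalTensor, principalPart_tensor_eq_sum 𝔚 η D hdisj j, stressSum_eq_sum,
    ← Finset.sum_sub_distrib]
  exact Finset.sum_congr rfl fun i _ =>
    principalSummand_tensor_sub_stressSummand 𝔚 η D (hdet i) hρ hm j

end Algebra

/-! ## Under the standing hypotheses -/

section Standing

variable {P : Params} {S : Setting} {Nbar : ℕ} {Cin C₀ c₀ : ℝ} {Cη : ℕ → ℕ → ℝ}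

/-- **(6.10) for the construction data under the standing hypotheses**: for `a ≥ 1`, `c₀ > 0` and
`ρ_q > 0` on `[0,T]` (Lemma 5.4), on `[0,T]`
`w_o ⊗ w_o - R̄_q = Σ_i ρ_{q,i} adj(∇Φ_i) 𝕎(R̃_{q,i}, n_{q+1}Φ_i) adj(∇Φ_i)ᵀ` — the cut-offs of a
`BDSV.PerturbationData` are disjoint (§5.2 (ii)), `Σ_j∫η_j² ≥ c₀ > 0` ((v)), and `det ∇Φ_i = 1`
for the backward flows of the divergence-free `v̄_q` (`OnsagerBDSVFlowJacobian.lean`).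
[cite: BuckmasterEtAl2018, §6.1.3 (arXiv (6.10))] -/
theorem PerturbationData.oscPrincipalTensor_eq_sum (H : PerturbationHypotheses P S Nbar Cin C₀)
    (𝒟 : PerturbationData P S c₀ Cη) (ha : 1 ≤ P.a) (hc₀ : 0 < c₀)
    (hρ : ∀ t ∈ Icc 0 S.T, 0 < rhoQ P S t) (𝔚 : MikadoDatum mikadoRadius) {t : ℝ}
    (ht : t ∈ Icc 0 S.T) (x : 𝕋³) (j : Fin 3) :
    oscPrincipalTensor P S 𝔚 𝒟.cut.η 𝒟.D t x j =
      ∑ i ∈ Finset.range (cutoffCount S.T (P.τ S.q)),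
        colsOf (principalOscMatrix P S 𝔚 𝒟.cut.η 𝒟.D i t x) j :=
  BDSV.oscPrincipalTensor_eq_sum 𝔚 𝒟.cut.η 𝒟.D (fun i i' h => 𝒟.cut.disjoint i i' h t x)
    (fun i => 𝒟.det_gradPhi_eq_one H ha i ht x) (hρ t ht)
    (lt_of_lt_of_le hc₀ (𝒟.cut.sum_sq_ge t ht)) j

end Standing

end BDSV

end Literature.Analysis.FluidPDE
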